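import Summits.QuantumAdvantage.AdviceFreeQNC0.SubRowDecimation38
import Summits.QuantumAdvantage.AdviceFreeQNC0.FibreDecimation37
import Summits.QuantumAdvantage.AdviceFreeQNC0.FibreDecimation37Laws
import Summits.QuantumAdvantage.AdviceFreeQNC0.BlockCombJoin37
import Summits.QuantumAdvantage.AdviceFreeQNC0.CubeUncertainty38
import HarnessLib

/-!
# Cell qa-qnc0 — p2 gen 38: SUB-ROW DECIMATION, typed over the tree's `Exp37` vocabulary (memo `qa-qnc0-p2/ROUND-38P2.md`)

Custody file (D-0168 E1 shelf: no ledger items; evidence on `stmt-QuantumAdvantage-22907`).  Everything is stated over the TREE port of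
p2 gen 37's fibre vocabulary (`Summits.QuantumAdvantage.AdviceFreeQNC0.FibreDecimation37{,Laws}`, namespace `…Exp37`: `Compatible`, `JCond`,
`decimSet`, `weightY`, `coset`, `testParity`, `affTarget`, `lettZ_ne_zero`, `neg_lettZ_ne`), so that a prover can port it verbatim.

Contents (namespace `Summit.QuantumAdvantage.AdviceFreeQNC0.Exp38p2`):
* **v2 (§3.3)**: `not_jCond_zero` (blind rows drop out), `jCond_of_supp_le_three` / `four_le_supp_of_not_jCond` (a row meeting `M`
  in ≤ 3 coins always survives) — the engines of the iterated rounds (Lemma 38.Q, Theorem 38.N) — PROVED.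
* **Lemma 38.A′ — PROVED (all `m`)**: `jCondIffCounts : JCond a δ ↔ δ ≠ 0 ∧ (defects a δ ≤ 1 ∨ agreements a δ ≤ 1)` — the J-condition in
  closed form (zeros are free; a row survives the `L_a`-decimation iff it has at most one sign defect against `a`, or at most one agreement).
  Corollaries: `not_jCond_of_two_two` (two defects and two agreements kill a row — the anti-seed exclusion of memo §3.1, containing p2's
  `mixedExcludes`), `jCond_of_single` (a row meeting `M` in exactly one coin always survives — the LOAD WALL of memo §3.1).
* **(NH_{s₀})** `NHs` and **Theorem 38.F** `FibreNonExact38` (target): 37.F′ with a SUB-ROW base row (`Compatible`, `≥ 2` non-zero entries;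
  Lemma 38.A) and the MIXED-NORM third step (short relations free; Lemma 38.C).
* **Corollary 38.E at `p = 1/2`** in the (J3) format of `BlockFibre37.PerOutputFormsHardConst` (`r = 1`, 0/1 forms): `SubsetFormsHardHalf`
  (target) and the bookkeeping `subsetFormsHardHalf_of_perOutput` (proved).
* **Conjecture 38.L** `InverseNearExact` — the inverse theorem for near-exact MOD-3 test systems (= p1's (L1) in adversarial form).
-/

noncomputable section

open Classical

namespace Summit.QuantumAdvantage.AdviceFreeQNC0.Exp38p2

open Finset
open Summit.QuantumAdvantage.AdviceFreeQNC0 F4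
open Summit.QuantumAdvantage.AdviceFreeQNC0.Exp37

variable {m : ℕ}

/-! (Tree port, qn-prover-3 g24: PART 2 of the custody file `qa-qnc0-p2/exp38p2/SubRowDecimation38.lean` v8, sha 10c66426b3b281ba —
(NH_{s₀}), Theorem 38.F, Corollary 38.E, Conjecture 38.L, the X-blindness criterion (v4, v7) and the gap-coin lemma, verbatim;
PART 1 = `SubRowDecimation38.lean`.) -/
/-! ### (NH_{s₀}) and Theorem 38.F -/

variable {z s : ℕ}

/-- The parity of the tests of a SUB-FAMILY `D` (used by Conjecture 38.L). -/
def testParityOn (D : Finset (Fin s)) (β : Fin s → Fin z → ZMod 3) (r : Fin s → ZMod 3) (u : Fin z → Bool) : ℕ :=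
  (D.filter fun k => test β r k u = true).card % 2

/-- Support size of a combination `j ∈ 𝔽₃^s`. -/
def relSuppCard (j : Fin s → ZMod 3) : ℕ := (univ.filter fun k => j k ≠ 0).card

/-- The SHORT MASS `S(n,s₀) = 3^{−n} Σ_{t ≤ s₀} C(n,t) 4^t` of Lemma 38.C (L¹ bound for the coefficients of support `≤ s₀`). -/
def shortMass (n s₀ : ℕ) : ℝ :=
  (3 : ℝ)⁻¹ ^ n * ∑ t ∈ range (s₀ + 1), ((n.choose t : ℕ) : ℝ) * 4 ^ t

/-- **Hypothesis (NH_{s₀})** for the decimated set `J = decimSet ι a β` (the memo uses the smaller `J' ⊆ J`; asking it of `J` is stronger):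
short mass `≤ 1/10` and LONG `3/4`-mass `Σ_{supp j ⊆ J, |supp j| > s₀} (3/4)^{w_Y(j)} ≤ 1/100`. -/
def NHs (ι : Fin m ↪ Fin z) (a : Fin m → Bool) (β : Fin s → Fin z → ZMod 3) (s₀ : ℕ) : Prop :=
  shortMass (decimSet ι a β).card s₀ ≤ 1 / 10 ∧
  (∑ j ∈ (univ : Finset (Fin s → ZMod 3)).filter
      (fun j => s₀ < relSuppCard j ∧ ∀ k, k ∉ decimSet ι a β → j k = 0),
      ((3 : ℝ) / 4) ^ weightY ι β j) ≤ 1 / 100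

/-- **Theorem 38.F (the fibre theorem of gen 38), typed target.**  `m` odd, `|Y| ≥ 1`; the base row `k₀` is `a`-COMPATIBLE on the chosen coins
(zeros allowed) with at least two non-zero entries (Lemma 38.A); (NH_{s₀}) for some `s₀` (Lemma 38.C).  Then every 𝔽₂-affine target is missed
on at least a `2^{−m−3}` fraction of the parity coset.  (37.F′ = the case `restrictM ι β k₀` nowhere zero and `s₀ = 0`.) -/
def FibreNonExact38 : Prop :=
  ∀ (z s m : ℕ) (ι : Fin m ↪ Fin z) (β : Fin s → Fin z → ZMod 3) (r : Fin s → ZMod 3) (k₀ : Fin s)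
    (a : Fin m → Bool) (s₀ : ℕ),
    Odd m → 1 ≤ z - m →
    Compatible a (restrictM ι β k₀) →
    2 ≤ (univ.filter fun i => β k₀ (ι i) ≠ 0).card →
    NHs ι a β s₀ →
    ∀ (ε μ₀ : ℕ) (S : Finset (Fin z)),
      (((coset z ε).filter fun u => testParity β r u % 2 = affTarget μ₀ S u % 2).card : ℝ)
        ≤ (1 - (2 : ℝ)⁻¹ ^ (m + 3)) * (2 : ℝ) ^ (z - 1)

/-! ### Corollary 38.E at `p = 1/2`, in the (J3) format -/

/-- The 0/1 indicator form of a committee `A ⊆ [n+1]`. -/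
def indForm {n : ℕ} (A : Finset (Fin (n + 1))) : Fin (n + 1) → ZMod 3 :=
  fun i => if i ∈ A then 1 else 0

/-- **Corollary 38.E (`p = 1/2`), typed target in the format of `BlockFibre37.PerOutputFormsHardConst` (`r = 1`, 0/1 forms).**
For all but an `e^{−κ n}` fraction of the committee families `A : Fin (n+1) → Finset (Fin (n+1))`, EVERY strategy in which output `g`
announces an arbitrary function `F g` of `|x ∩ A_g| mod 3` (charge `c`) wins the transported ring game on at most `θ·2^n` walks.
(Memo: `θ = 1 − 2^{−63}`.) -/
def SubsetFormsHardHalf : Prop :=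
  ∃ θ : ℝ, θ < 1 ∧ ∃ κ : ℝ, 0 < κ ∧ ∃ n₀ : ℕ, ∀ n ≥ n₀,
    (((univ : Finset (Fin (n + 1) → Finset (Fin (n + 1)))).filter fun A =>
        ∃ (c : ℕ) (F : Fin (n + 1) → ZMod 3 → Bool),
          θ * (2 : ℝ) ^ n <
            (((univ : Finset (Fin n → Bool)).filter fun u =>
                ringWinU c (fun g u => F g (BlockFibre37.gateSum (indForm (A g)) u)) u = true).card : ℝ)).card : ℝ)
      ≤ Real.exp (-(κ * n)) * (2 : ℝ) ^ ((n + 1) * (n + 1))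

/-- Bookkeeping: (J3) for every family implies the almost-every-family statement trivially. -/
theorem subsetFormsHardHalf_of_perOutput (h : BlockFibre37.PerOutputFormsHardConst) : SubsetFormsHardHalf := by
  obtain ⟨θ, hθ, hall⟩ := h
  obtain ⟨n₀, hn₀⟩ := hall 1
  refine ⟨θ, hθ, 1, one_pos, n₀, fun n hn => ?_⟩
  have hempty : ((univ : Finset (Fin (n + 1) → Finset (Fin (n + 1)))).filter fun A =>
        ∃ (c : ℕ) (F : Fin (n + 1) → ZMod 3 → Bool),
          θ * (2 : ℝ) ^ n <
            (((univ : Finset (Fin n → Bool)).filter fun u =>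
                ringWinU c (fun g u => F g (BlockFibre37.gateSum (indForm (A g)) u)) u = true).card : ℝ)) = ∅ := by
    apply filter_eq_empty_iff.mpr
    intro A _ hA
    obtain ⟨c, F, hlt⟩ := hA
    have hle := hn₀ n hn (fun g (_ : Fin 1) => indForm (A g)) c (fun g v => F g (v 0))
    exact absurd hle (not_le.mpr hlt)
  rw [hempty]
  simp only [card_empty, CharP.cast_eq_zero]
  positivity

/-! ### Conjecture 38.L — the inverse theorem for near-exact systems -/

/-- Pairwise non-proportional, non-zero directions (fibre twins merged, blind rows removed). -/
def Reduced (β : Fin s → Fin z → ZMod 3) : Prop :=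
  (∀ k, β k ≠ 0) ∧ ∀ k k', k ≠ k' → β k ≠ β k' ∧ β k ≠ -β k'

/-- `𝔽₃`-rank of the directions of the class `{k : cls k = f}`. -/
def classRank (β : Fin s → Fin z → ZMod 3) (cls : Fin s → ℕ) (f : ℕ) : ℕ :=
  Module.finrank (ZMod 3) (Submodule.span (ZMod 3) (Set.range fun k : {k : Fin s // cls k = f} => β k.1))

/-- **Conjecture 38.L (inverse theorem; = p1's (L1) in adversarial form).**  There are `C, η₀ > 0` such that every REDUCED test system whose
parity agrees with an 𝔽₂-affine target on a `≥ 1 − η` fraction of a parity coset (`η ≤ η₀`) splits into classes, each spanning an `𝔽₃`-space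
of dimension `≤ C·(log₃ s + log₃ η⁻¹ + 1)` and each with an almost constant sub-parity.  Calibration (memo §3.2): all directions of a
`b`-block (rank `log₃(2T+1)`, defect `2^{−b}`), projective families (rank `R`, defect `2·3^{−R}`), unions (hence PER-CLASS rank). -/
def InverseNearExact : Prop :=
  ∃ (C : ℕ) (η₀ : ℝ), 0 < η₀ ∧
    ∀ (z s : ℕ) (β : Fin s → Fin z → ZMod 3) (r : Fin s → ZMod 3) (ε μ₀ : ℕ) (S : Finset (Fin z)) (η : ℝ),
      0 < η → η ≤ η₀ → Reduced β →
      (1 - η) * (2 : ℝ) ^ (z - 1) ≤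
        (((coset z ε).filter fun u => testParity β r u % 2 = affTarget μ₀ S u % 2).card : ℝ) →
      ∃ cls : Fin s → ℕ, ∀ f : ℕ,
        (classRank β cls f : ℝ) ≤ C * (Real.logb 3 s + Real.logb 3 η⁻¹ + 1) ∧
        ∃ b : ℕ, (1 - Real.sqrt η) * (2 : ℝ) ^ (z - 1) ≤
          (((coset z ε).filter fun u => testParityOn (univ.filter fun k => cls k = f) β r u = b % 2).card : ℝ)


/-! ### v4 (§3.5): the X-blindness criterion behind Lemma 38.W

A sum of MOD-3 tests `Σ_k [x ≢ ρ_k]` is constant in `x` (mod 2) iff the three residue-class counts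
`#{k : ρ_k = v}` have equal parity.  This is the combinatorial core of the bulk-free collapse (38.W, (XB)). -/

/-- number of tests `[x ≢ ρ_k]` firing at `x`. -/
def fireCount {T : ℕ} (ρ : Fin T → ZMod 3) (x : ZMod 3) : ℕ :=
  (univ.filter fun k => ¬ ρ k = x).card

/-- number of tests with residue exactly `v`. -/
def resCount {T : ℕ} (ρ : Fin T → ZMod 3) (v : ZMod 3) : ℕ :=
  (univ.filter fun k => ρ k = v).card

/-- Residue count at `x` plus firing count at `x` is the number of tests. -/
theorem resCount_add_fireCount {T : ℕ} (ρ : Fin T → ZMod 3) (x : ZMod 3) :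
    resCount ρ x + fireCount ρ x = T := by
  unfold resCount fireCount
  have h := Finset.card_filter_add_card_filter_not
    (s := (univ : Finset (Fin T))) (p := fun k => ρ k = x)
  simpa using h

/-- A residue count is at most the number of tests. -/
theorem resCount_le {T : ℕ} (ρ : Fin T → ZMod 3) (v : ZMod 3) : resCount ρ v ≤ T := by
  have := resCount_add_fireCount ρ v; omega

/-- parity of the firing count is the same at `x` and `y` iff the residue counts at `x` and `y`
have the same parity. -/
theorem fireCount_mod_two_eq_iff {T : ℕ} (ρ : Fin T → ZMod 3) (x y : ZMod 3) :
    fireCount ρ x % 2 = fireCount ρ y % 2 ↔ resCount ρ x % 2 = resCount ρ y % 2 := by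
  have hx := resCount_add_fireCount ρ x
  have hy := resCount_add_fireCount ρ y
  omega

/-- **X-blindness criterion** (core of Lemma 38.W / (XB)): the test sum `x ↦ Σ_k [x ≢ ρ_k] mod 2`
is constant on `𝔽₃` iff the residue-class counts all have the same parity. -/
theorem testSum_const_iff {T : ℕ} (ρ : Fin T → ZMod 3) :
    (∀ x y : ZMod 3, fireCount ρ x % 2 = fireCount ρ y % 2) ↔
      (resCount ρ 0 % 2 = resCount ρ 1 % 2 ∧ resCount ρ 1 % 2 = resCount ρ 2 % 2) := by
  constructor
  · intro h
    exact ⟨(fireCount_mod_two_eq_iff ρ 0 1).1 (h 0 1), (fireCount_mod_two_eq_iff ρ 1 2).1 (h 1 2)⟩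
  · rintro ⟨h01, h12⟩ x y
    rw [fireCount_mod_two_eq_iff]
    have h3 : ∀ z : ZMod 3, z = 0 ∨ z = 1 ∨ z = 2 := by decide
    rcases h3 x with rfl | rfl | rfl <;> rcases h3 y with rfl | rfl | rfl <;> omega

/-- sanity instance: residues `(0,1,2)` — counts `(1,1,1)`, all odd — give a constant test sum. -/
example : ∀ x y : ZMod 3, fireCount (![0, 1, 2] : Fin 3 → ZMod 3) x % 2
    = fireCount (![0, 1, 2] : Fin 3 → ZMod 3) y % 2 := by decide

/-- sanity instance: a single test is never X-blind. -/
example : ¬ ∀ x y : ZMod 3, fireCount (![0] : Fin 1 → ZMod 3) x % 2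
    = fireCount (![0] : Fin 1 → ZMod 3) y % 2 := by decide

/-! ### v5/v6 (§3.6): the cube uncertainty principle (Proposition 38.X) — NOW A TREE THEOREM

Typed here in v5 as `Exp38p2.CubeUncertainty` (exponent-`2` form `2^m ≤ T²·#supp`) and proved in v6 of this file; since
2026-08-29 21:11Z it is typed AND proved in the TREE, `Summits.QuantumAdvantage.AdviceFreeQNC0.CubeUncertainty38`
(`Exp38p2.charCombo`, `Exp38p2.CubeUncertainty`, `Exp38p2.cubeUncertainty`, general-index form `cube_uncertainty_card`;
prover port, independent proof of the same induction).  This file now IMPORTS the tree theorem; the custody file's own v6 proof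
(`cube_uncertainty_aux`, evidence on stmt-22907 @21:10:05Z/@21:14:42Z) is superseded and removed to avoid name clashes. -/

/-- Proposition 38.X is available from the tree. -/
example : CubeUncertainty := cubeUncertainty


/-! ### v7 (§3.5, criterion (XB)): the `𝔽₄` form of X-blindness

`(fireCount ρ x : 𝔽₄) = tr (ω^{2x} · Σ_k ω^{ρ_k})`, and the test sum `x ↦ Σ_k [x ≢ ρ_k] mod 2` is constant
on `𝔽₃` iff the character sum `Σ_k ω^{ρ_k}` vanishes in `𝔽₄` — the link between `testSum_const_iff`
and the function `B(α)` of (XB) / Proposition 38.X. -/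

/-- the `𝔽₄` character sum of a residue vector. -/
def charSum {T : ℕ} (ρ : Fin T → ZMod 3) : F4 := ∑ k, ω ^ (ρ k).val

/-- `2a + b ≡ 0 (mod 3)` iff `b = a` in `ℤ/3`. -/
theorem val_key (a b : ZMod 3) : ((2 * a.val + b.val) % 3 = 0) ↔ b = a := by
  revert a b; decide

/-- the firing count, cast into `𝔽₄`, is a trace of the twisted character sum. -/
theorem fireCount_cast {T : ℕ} (ρ : Fin T → ZMod 3) (x : ZMod 3) :
    (fireCount ρ x : F4) = tr (ω ^ (2 * x.val) * charSum ρ) := by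
  unfold fireCount charSum
  rw [Finset.card_filter, Nat.cast_sum, Finset.mul_sum, tr_sum]
  refine Finset.sum_congr rfl ?_
  intro k _
  rw [← pow_add, tr_omega_pow, Nat.cast_ite, Nat.cast_one, Nat.cast_zero]
  by_cases h : ρ k = x
  · rw [if_neg (not_not.mpr h), if_pos ((val_key x (ρ k)).mpr h)]
  · rw [if_pos h, if_neg (fun h' => h ((val_key x (ρ k)).mp h'))]

/-- three equal traces force zero: `tr S = tr (ω² S) = tr (ω S) ⇒ S = 0`. -/
theorem eq_zero_of_tr_eq (S : F4) (h1 : tr S = tr (ω ^ 2 * S)) (h2 : tr S = tr (ω * S)) :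
    S = 0 := by
  unfold tr at h1 h2
  have h4 : ω ^ 4 = ω := by rw [omega_pow_mod, show 4 % 3 = 1 by rfl, pow_one]
  have hA : S + S ^ 2 = ω ^ 2 * S + ω * S ^ 2 := by
    rw [h1, mul_pow, ← pow_mul, show 2 * 2 = 4 by rfl, h4]
  have hB : S + S ^ 2 = ω * S + ω ^ 2 * S ^ 2 := by
    rw [h2, mul_pow]
  linear_combination ω * hA + ω ^ 2 * hB - (S + S ^ 2 * ω * (1 - ω)) * omega_add_omega_sq
    + (ω ^ 3 * S - S ^ 2 * ω * (1 - ω)) * two_eq_zero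

/-- **(XB) in `𝔽₄`**: the test sum is constant iff the character sum vanishes. -/
theorem testSum_const_iff_charSum {T : ℕ} (ρ : Fin T → ZMod 3) :
    (∀ x y : ZMod 3, fireCount ρ x % 2 = fireCount ρ y % 2) ↔ charSum ρ = 0 := by
  constructor
  · intro h
    have hc : ∀ x y : ZMod 3, (fireCount ρ x : F4) = (fireCount ρ y : F4) := by
      intro x y
      rw [natCast_eq, natCast_eq, h x y]
    have h1 := hc 0 1
    have h2 := hc 0 2
    rw [fireCount_cast, fireCount_cast] at h1 h2
    rw [show (0 : ZMod 3).val = 0 from rfl, show (1 : ZMod 3).val = 1 from rfl] at h1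
    rw [show (0 : ZMod 3).val = 0 from rfl, show (2 : ZMod 3).val = 2 from rfl] at h2
    have h4 : ω ^ (2 * 2) = ω := by rw [omega_pow_mod, show 2 * 2 % 3 = 1 by rfl, pow_one]
    rw [mul_zero, pow_zero, one_mul, mul_one] at h1
    rw [mul_zero, pow_zero, one_mul, h4] at h2
    exact eq_zero_of_tr_eq _ h1 h2
  · intro h x y
    haveI := F4.nontrivial
    have hx : (fireCount ρ x : F4) = 0 := by rw [fireCount_cast, h, mul_zero, tr_zero]
    have hy : (fireCount ρ y : F4) = 0 := by rw [fireCount_cast, h, mul_zero, tr_zero]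
    rw [natCast_eq] at hx hy
    split_ifs at hx with hx1 <;> split_ifs at hy with hy1
    all_goals first | exact absurd hx one_ne_zero | exact absurd hy one_ne_zero | omega

/-- corollary: X-blindness ⟺ `Σ_k ω^{ρ_k} = 0` ⟺ equal-parity residue counts. -/
theorem charSum_eq_zero_iff_counts {T : ℕ} (ρ : Fin T → ZMod 3) :
    charSum ρ = 0 ↔
      (resCount ρ 0 % 2 = resCount ρ 1 % 2 ∧ resCount ρ 1 % 2 = resCount ρ 2 % 2) := by
  rw [← testSum_const_iff_charSum, testSum_const_iff]

/-! ### v7b (Lemma 38.W (i), deterministic core): the top gap coin has at most ONE blind value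

If the residue vector is extended by one position, at most one value of that position makes the test sum
constant ("the unique equalising class" of §3.5): `charSum (snoc ρ a) = charSum (snoc ρ b) = 0 ⇒ a = b`. -/

/-- `1 ≠ ω` in `𝔽₄`. -/
theorem one_ne_omega : (1 : F4) ≠ ω := by
  haveI := F4.nontrivial
  intro e
  have w := omega_add_omega_sq
  rw [← e, one_pow, add_self] at w
  exact zero_ne_one w

/-- `ω ≠ ω²` in `𝔽₄`. -/
theorem omega_ne_omega_sq : ω ≠ ω ^ 2 := by
  haveI := F4.nontrivial
  intro e
  have w := omega_add_omega_sq
  rw [← e, add_self] at w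
  exact zero_ne_one w

/-- `1 ≠ ω²` in `𝔽₄`. -/
theorem one_ne_omega_sq : (1 : F4) ≠ ω ^ 2 := by
  haveI := F4.nontrivial
  intro e
  have w := omega_add_omega_sq
  rw [← e] at w
  have h0 : ω = 0 := by simpa using w
  rw [h0] at e
  simp at e

/-- `v ↦ ω^{v}` is injective on `𝔽₃` (`1, ω, ω²` are distinct). -/
theorem omega_pow_val_inj (a b : ZMod 3) (h : ω ^ a.val = ω ^ b.val) : a = b := by
  apply ZMod.val_injective 3
  have ha : a.val < 3 := a.val_lt
  have hb : b.val < 3 := b.val_lt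
  generalize ea : a.val = i at *
  generalize eb : b.val = j at *
  interval_cases i <;> interval_cases j
  · rfl
  · exact absurd (by simpa using h) one_ne_omega
  · exact absurd (by simpa using h) one_ne_omega_sq
  · exact absurd (by simpa using h.symm) one_ne_omega
  · rfl
  · exact absurd (by simpa using h) omega_ne_omega_sq
  · exact absurd (by simpa using h.symm) one_ne_omega_sq
  · exact absurd (by simpa using h.symm) omega_ne_omega_sq
  · rfl

/-- The character sum of an extended residue vector. -/
theorem charSum_snoc {T : ℕ} (ρ : Fin T → ZMod 3) (a : ZMod 3) :
    charSum (Fin.snoc ρ a : Fin (T + 1) → ZMod 3) = charSum ρ + ω ^ a.val := by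
  unfold charSum
  rw [Fin.sum_univ_castSucc]
  simp only [Fin.snoc_castSucc, Fin.snoc_last]

/-- **gap-coin lemma**: two different top residues cannot both make the character sum vanish. -/
theorem gap_coin_unique {T : ℕ} (ρ : Fin T → ZMod 3) (a b : ZMod 3)
    (ha : charSum (Fin.snoc ρ a : Fin (T + 1) → ZMod 3) = 0)
    (hb : charSum (Fin.snoc ρ b : Fin (T + 1) → ZMod 3) = 0) : a = b := by
  rw [charSum_snoc] at ha hb
  apply omega_pow_val_inj
  have e : charSum ρ + ω ^ a.val = charSum ρ + ω ^ b.val := by rw [ha, hb]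
  exact add_left_cancel e

/-- the same in terms of test sums: at most one value of the top position is X-blind. -/
theorem top_position_unique_blind {T : ℕ} (ρ : Fin T → ZMod 3) (a b : ZMod 3)
    (ha : ∀ x y : ZMod 3, fireCount (Fin.snoc ρ a : Fin (T + 1) → ZMod 3) x % 2 =
      fireCount (Fin.snoc ρ a : Fin (T + 1) → ZMod 3) y % 2)
    (hb : ∀ x y : ZMod 3, fireCount (Fin.snoc ρ b : Fin (T + 1) → ZMod 3) x % 2 =
      fireCount (Fin.snoc ρ b : Fin (T + 1) → ZMod 3) y % 2) : a = b :=
  gap_coin_unique ρ a b ((testSum_const_iff_charSum _).mp ha) ((testSum_const_iff_charSum _).mp hb)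

end Summit.QuantumAdvantage.AdviceFreeQNC0.Exp38p2
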